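import Mathlib
import Summits.NavierStokesRegularity.NavierStokesRegularity.Theorems.EulerZoomLiouvillePowerGaugeEulerLiouvilleDSSVorticalNodeThin
import HarnessLib.Audit

/-!
# Crux E `PowerGaugeEulerLiouville` (stmt-NavierStokesRegularity-19832): THE VORTICITY COCYCLE ALONG THE PHASE LATTICE AND THE «COCYCLE KILL» AT A LIMIT POINT
# (width seat ns-cas-k2 g3, lane «DSS thin vortical nodes», tool D)

Route `EulerZoomLiouville` (NavierStokesRegularity), crux E.  `u` classical Euler on `(−∞,0)` with the Cauchy–Lipschitz hypotheses, `l`-DSS (`T = l^{2+ρ}`); `F(x) = φ(τ₀,Tτ₀,lx)`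
the rescaled period map at the phase `τ₀ < 0` (…DSSVorticalNodeThin).  Along a backward trajectory `X` from `(τ₀,x₀)` put `q_j := l^{−j}X(Tʲτ₀)` and
`ω_j := ω(Tʲτ₀, X(Tʲτ₀))`.
* `periodMap_lattice` — `F(q_{j+1}) = q_j` (DSS conjugation + group law);
* `fderiv_dss_conj` — `Dφ(Tʲτ₀, Tʲ⁺¹τ₀, ·)(lʲz) = Dφ(τ₀,Tτ₀,·)(z)`: the one-period tangent maps are DSS-invariant;
* **`curl_lattice_cocycle`** — THE VORTICITY COCYCLE `ω_j = l⁻¹ · DF(q_{j+1}) ω_{j+1}` (Cauchy's formula between lattice times);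
* `norm_prod_sub_pow_le` — telescoping: a product of `k` operators each `η`-close to `M` (`η ≤ 1`) is within `kη(‖M‖+1)^k` of `M^k`;
* **`curl_eq_zero_of_tendsto_of_normPow_lt`** — COCYCLE KILL: if `(−s)‖ω(s,X(s))‖ ≤ C` for `s ≤ τ₀` (Type I along the trajectory), `q_j → x*` and
  `‖DF(x*)^{k₀}‖ < (lT)^{k₀}` for some `k₀ ≥ 1`, then `ω(τ₀, x₀) = 0`.  (`lT` is exactly the eigenvalue of the vorticity at a VORTICAL permanent node,
  `fderiv_periodMap_node`; the condition is the sharp linearised kill condition at NON-vortical limit nodes and needs no node property of `x*`.)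

WHAT THIS IS NOT: not NS regularity, not the crux E — Lagrangian bookkeeping for hypothetical DSS blow-up members; 19832 is OPEN.
[folklore; MajdaBertozziCUP2002 §1.6 Prop. 1.8 (1.51)]
-/

noncomputable section

set_option linter.dupNamespace false

open MeasureTheory Set Filter Topology Metric Function
open scoped NNReal ENNReal ContDiff InnerProductSpace RealInnerProductSpace

namespace Summit.NavierStokesRegularity.NavierStokesRegularity.Theorems.PowerGaugeEulerLiouville.DSSNodes

open Literature.Analysis Literature.Analysis.FluidPDE
open Summit.NavierStokesRegularity.NavierStokesRegularity.Theorems.PowerGaugeEulerLiouville.SimilarityBernoulli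

variable {u : ℝ → EuclideanSpace ℝ (Fin 3) → EuclideanSpace ℝ (Fin 3)} {p : ℝ → EuclideanSpace ℝ (Fin 3) → ℝ} {ρ l : ℝ}

/-! ### The phase lattice of a trajectory under the period map -/

/-- **`F(q_{j+1}) = q_j`** for `q_j = l^{−j}φ(Tʲτ₀, τ₀, x₀)` and the rescaled period map `F(x) = φ(τ₀, Tτ₀, lx)`. [folklore] -/
theorem periodMap_lattice (hL : ODE.IsUniformlyLipschitzOn u (Iio 0)) (hl : 1 < l) (hρ : 0 < 2 + ρ)
    (hdss : ∀ τ : ℝ, τ < 0 → ∀ y, u τ y = (l ^ (1 + ρ)) • u ((l ^ (2 + ρ)) * τ) (l • y))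
    {τ₀ : ℝ} (hτ₀ : τ₀ < 0) (x₀ : EuclideanSpace ℝ (Fin 3)) (j : ℕ) :
    ODE.evolutionMap u (l ^ (2 + ρ) * τ₀) τ₀
        (l • ((l ^ (j + 1))⁻¹ • ODE.evolutionMap u τ₀ ((l ^ (2 + ρ)) ^ (j + 1) * τ₀) x₀)) =
      (l ^ j)⁻¹ • ODE.evolutionMap u τ₀ ((l ^ (2 + ρ)) ^ j * τ₀) x₀ := by
  -- adapted from the tail of `volume_setOf_tendsto_vorticalNode_eq_zero`
  have hl0 : 0 < l := zero_lt_one.trans hl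
  set T : ℝ := l ^ (2 + ρ) with hT
  have hT0 : 0 < T := Real.rpow_pos_of_pos hl0 _
  have hTτ₀ : T * τ₀ < 0 := mul_neg_of_pos_of_neg hT0 hτ₀
  have hlj : 0 < l ^ j := pow_pos hl0 j
  have hTj : (l ^ j) ^ (2 + ρ) = T ^ j := rpow_natPow_comm hl0.le (2 + ρ) j
  have hconj := evolutionMap_dss_conj hL hlj (dss_pow hl hρ hdss j) hTτ₀ hτ₀
    (ODE.evolutionMap u τ₀ (T ^ (j + 1) * τ₀) x₀)
  rw [hTj, ← mul_assoc, ← pow_succ] at hconj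
  have hTj1 : T ^ (j + 1) * τ₀ < 0 := mul_neg_of_pos_of_neg (pow_pos hT0 _) hτ₀
  have hTj0 : T ^ j * τ₀ < 0 := mul_neg_of_pos_of_neg (pow_pos hT0 _) hτ₀
  have htrans : ODE.evolutionMap u (T ^ (j + 1) * τ₀) (T ^ j * τ₀) (ODE.evolutionMap u τ₀ (T ^ (j + 1) * τ₀) x₀) =
      ODE.evolutionMap u τ₀ (T ^ j * τ₀) x₀ :=
    hL.evolutionMap_trans (convex_Iio 0) (mem_Iio.2 hτ₀) (mem_Iio.2 hTj1) (mem_Iio.2 hTj0) x₀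
  rw [htrans] at hconj
  rw [smul_smul, show l * (l ^ (j + 1))⁻¹ = (l ^ j)⁻¹ by rw [pow_succ]; field_simp, hconj, smul_smul,
    inv_mul_cancel₀ hlj.ne', one_smul]

/-- **The one-period tangent maps are DSS-invariant**: `Dφ(Tʲb, Tʲa, ·)(lʲ z) = Dφ(b, a, ·)(z)` (`a, b < 0`). [folklore] -/
theorem fderiv_dss_conj (hcl : IsClassicalEulerSolutionOn (Iio 0) 0 u p) (hL : ODE.IsUniformlyLipschitzOn u (Iio 0)) (hl : 1 < l)
    (hρ : 0 < 2 + ρ) (hdss : ∀ τ : ℝ, τ < 0 → ∀ y, u τ y = (l ^ (1 + ρ)) • u ((l ^ (2 + ρ)) * τ) (l • y))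
    {a b : ℝ} (ha : a < 0) (hb : b < 0) (j : ℕ) (z : EuclideanSpace ℝ (Fin 3)) :
    fderiv ℝ (ODE.evolutionMap u ((l ^ (2 + ρ)) ^ j * a) ((l ^ (2 + ρ)) ^ j * b)) (l ^ j • z) =
      fderiv ℝ (ODE.evolutionMap u a b) z := by
  have hl0 : 0 < l := zero_lt_one.trans hl
  have hlj : 0 < l ^ j := pow_pos hl0 j
  have hTj : (l ^ j) ^ (2 + ρ) = (l ^ (2 + ρ)) ^ j := rpow_natPow_comm hl0.le (2 + ρ) j
  have hfun : ODE.evolutionMap u ((l ^ (2 + ρ)) ^ j * a) ((l ^ (2 + ρ)) ^ j * b) =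
      fun w => l ^ j • ODE.evolutionMap u a b ((l ^ j)⁻¹ • w) := by
    funext w
    have h := evolutionMap_dss_conj hL hlj (dss_pow hl hρ hdss j) ha hb w
    rwa [hTj] at h
  rw [hfun]
  have hΦd : Differentiable ℝ (ODE.evolutionMap u a b) :=
    (contDiff_evolutionMap_any hcl hL ha hb).differentiable (by simp)
  have h1 : HasFDerivAt (ODE.evolutionMap u a b) (fderiv ℝ (ODE.evolutionMap u a b) z) ((l ^ j)⁻¹ • (l ^ j • z)) := by
    rw [smul_smul, inv_mul_cancel₀ hlj.ne', one_smul]; exact (hΦd z).hasFDerivAt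
  have h2 : HasFDerivAt (fun w : EuclideanSpace ℝ (Fin 3) => (l ^ j)⁻¹ • w)
      ((l ^ j)⁻¹ • ContinuousLinearMap.id ℝ (EuclideanSpace ℝ (Fin 3))) (l ^ j • z) :=
    ((l ^ j)⁻¹ • ContinuousLinearMap.id ℝ (EuclideanSpace ℝ (Fin 3))).hasFDerivAt
  have h3 : HasFDerivAt (fun w : EuclideanSpace ℝ (Fin 3) => l ^ j • ODE.evolutionMap u a b ((l ^ j)⁻¹ • w))
      (l ^ j • (fderiv ℝ (ODE.evolutionMap u a b) z).comp ((l ^ j)⁻¹ • ContinuousLinearMap.id ℝ (EuclideanSpace ℝ (Fin 3))))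
      (l ^ j • z) := (h1.comp (l ^ j • z) h2).const_smul (l ^ j)
  rw [h3.fderiv]
  ext v
  simp only [smul_apply, ContinuousLinearMap.comp_apply, ContinuousLinearMap.id_apply, map_smul, smul_smul,
    mul_inv_cancel₀ hlj.ne', one_smul]

/-- **THE VORTICITY COCYCLE ALONG THE PHASE LATTICE**: with `q_j = l^{−j}φ(Tʲτ₀,τ₀,x₀)`, `ω_j = ω(Tʲτ₀, φ(Tʲτ₀,τ₀,x₀))` and the period map
`F(x) = φ(τ₀,Tτ₀,lx)`: `ω_j = l⁻¹·DF(q_{j+1})·ω_{j+1}`. [cite: MajdaBertozziCUP2002, §1.6 Prop. 1.8 (1.51)] -/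
theorem curl_lattice_cocycle (hcl : IsClassicalEulerSolutionOn (Iio 0) 0 u p) (hL : ODE.IsUniformlyLipschitzOn u (Iio 0)) (hl : 1 < l)
    (hρ : 0 < 2 + ρ) (hdss : ∀ τ : ℝ, τ < 0 → ∀ y, u τ y = (l ^ (1 + ρ)) • u ((l ^ (2 + ρ)) * τ) (l • y))
    {τ₀ : ℝ} (hτ₀ : τ₀ < 0) (x₀ : EuclideanSpace ℝ (Fin 3)) (j : ℕ) :
    curl (u ((l ^ (2 + ρ)) ^ j * τ₀)) (ODE.evolutionMap u τ₀ ((l ^ (2 + ρ)) ^ j * τ₀) x₀) =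
      l⁻¹ • fderiv ℝ (fun x : EuclideanSpace ℝ (Fin 3) => ODE.evolutionMap u (l ^ (2 + ρ) * τ₀) τ₀ (l • x))
        ((l ^ (j + 1))⁻¹ • ODE.evolutionMap u τ₀ ((l ^ (2 + ρ)) ^ (j + 1) * τ₀) x₀)
        (curl (u ((l ^ (2 + ρ)) ^ (j + 1) * τ₀)) (ODE.evolutionMap u τ₀ ((l ^ (2 + ρ)) ^ (j + 1) * τ₀) x₀)) := by
  have hl0 : 0 < l := zero_lt_one.trans hl
  set T : ℝ := l ^ (2 + ρ) with hT
  have hT0 : 0 < T := Real.rpow_pos_of_pos hl0 _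
  have hTτ₀ : T * τ₀ < 0 := mul_neg_of_pos_of_neg hT0 hτ₀
  have hTj1 : T ^ (j + 1) * τ₀ < 0 := mul_neg_of_pos_of_neg (pow_pos hT0 _) hτ₀
  have hTj0 : T ^ j * τ₀ < 0 := mul_neg_of_pos_of_neg (pow_pos hT0 _) hτ₀
  set a : EuclideanSpace ℝ (Fin 3) := ODE.evolutionMap u τ₀ (T ^ (j + 1) * τ₀) x₀ with ha
  set q : EuclideanSpace ℝ (Fin 3) := (l ^ (j + 1))⁻¹ • a with hq
  -- Cauchy between the two lattice times
  have hcauchy := curl_evolutionMap_any hcl hL hTj1 hTj0 a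
  have htrans : ODE.evolutionMap u (T ^ (j + 1) * τ₀) (T ^ j * τ₀) a = ODE.evolutionMap u τ₀ (T ^ j * τ₀) x₀ :=
    hL.evolutionMap_trans (convex_Iio 0) (mem_Iio.2 hτ₀) (mem_Iio.2 hTj1) (mem_Iio.2 hTj0) x₀
  rw [htrans] at hcauchy
  -- the tangent map at `a = l^{j+1} q` is the one-period tangent map at `l q`
  have ha' : a = l ^ j • (l • q) := by
    rw [hq, smul_smul, smul_smul, pow_succ, mul_inv_cancel₀ (by positivity), one_smul]
  clear_value q
  have hD : fderiv ℝ (ODE.evolutionMap u (T ^ (j + 1) * τ₀) (T ^ j * τ₀)) a = fderiv ℝ (ODE.evolutionMap u (T * τ₀) τ₀) (l • q) := by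
    rw [ha', show T ^ (j + 1) * τ₀ = T ^ j * (T * τ₀) by rw [pow_succ]; ring]
    exact fderiv_dss_conj hcl hL hl hρ hdss hTτ₀ hτ₀ j (l • q)
  -- the period map's derivative: `DF(q) = DΦ(lq) ∘ (l·id)`
  have hΦd : Differentiable ℝ (ODE.evolutionMap u (T * τ₀) τ₀) :=
    (contDiff_evolutionMap_any hcl hL hTτ₀ hτ₀).differentiable (by simp)
  have hDF : fderiv ℝ (fun x : EuclideanSpace ℝ (Fin 3) => ODE.evolutionMap u (T * τ₀) τ₀ (l • x)) q =
      (fderiv ℝ (ODE.evolutionMap u (T * τ₀) τ₀) (l • q)).comp (l • ContinuousLinearMap.id ℝ (EuclideanSpace ℝ (Fin 3))) := by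
    have h1 : HasFDerivAt (ODE.evolutionMap u (T * τ₀) τ₀) (fderiv ℝ (ODE.evolutionMap u (T * τ₀) τ₀) (l • q)) (l • q) :=
      (hΦd _).hasFDerivAt
    have h2 : HasFDerivAt (fun x : EuclideanSpace ℝ (Fin 3) => l • x)
        (l • ContinuousLinearMap.id ℝ (EuclideanSpace ℝ (Fin 3))) q :=
      (l • ContinuousLinearMap.id ℝ (EuclideanSpace ℝ (Fin 3))).hasFDerivAt
    exact (h1.comp q h2).fderiv
  rw [hcauchy, hD, hDF, ContinuousLinearMap.comp_apply, smul_apply, ContinuousLinearMap.id_apply, map_smul, smul_smul,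
    inv_mul_cancel₀ hl0.ne', one_smul]

/-! ### Products of operators close to a fixed one -/

/-- **Telescoping**: if `‖D i − M‖ ≤ η ≤ 1` for all `i`, the recursive products `P 0 = 1`, `P (k+1) = P k * D k` satisfy `‖P k‖ ≤ (‖M‖+1)^k` and
`‖P k − M^k‖ ≤ k·η·(‖M‖+1)^k`. [folklore] -/
theorem norm_prod_sub_pow_le {M : EuclideanSpace ℝ (Fin 3) →L[ℝ] EuclideanSpace ℝ (Fin 3)}
    {D : ℕ → (EuclideanSpace ℝ (Fin 3) →L[ℝ] EuclideanSpace ℝ (Fin 3))}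
    {P : ℕ → (EuclideanSpace ℝ (Fin 3) →L[ℝ] EuclideanSpace ℝ (Fin 3))} (hP0 : P 0 = 1) (hP : ∀ k, P (k + 1) = P k * D k)
    {η : ℝ} (hη0 : 0 ≤ η) (hη1 : η ≤ 1) (hD : ∀ i, ‖D i - M‖ ≤ η) (k : ℕ) :
    ‖P k‖ ≤ (‖M‖ + 1) ^ k ∧ ‖P k - M ^ k‖ ≤ k * η * (‖M‖ + 1) ^ k := by
  induction k with
  | zero =>
      rw [hP0, pow_zero]
      exact ⟨by simp, by simp⟩
  | succ k ih =>
      obtain ⟨h1, h2⟩ := ih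
      have hDk : ‖D k‖ ≤ ‖M‖ + 1 := by
        have := norm_le_insert' (D k) M
        calc ‖D k‖ ≤ ‖M‖ + ‖D k - M‖ := norm_le_insert' _ _
          _ ≤ ‖M‖ + 1 := by linarith [hD k]
      refine ⟨?_, ?_⟩
      · rw [hP k, pow_succ]
        calc ‖P k * D k‖ ≤ ‖P k‖ * ‖D k‖ := norm_mul_le _ _
          _ ≤ (‖M‖ + 1) ^ k * (‖M‖ + 1) := mul_le_mul h1 hDk (norm_nonneg _) (by positivity)
      · rw [hP k, pow_succ]
        have e : P k * D k - M ^ k * M = P k * (D k - M) + (P k - M ^ k) * M := by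
          rw [mul_sub, sub_mul]; abel
        rw [e]
        calc ‖P k * (D k - M) + (P k - M ^ k) * M‖ ≤ ‖P k * (D k - M)‖ + ‖(P k - M ^ k) * M‖ := norm_add_le _ _
          _ ≤ ‖P k‖ * ‖D k - M‖ + ‖P k - M ^ k‖ * ‖M‖ := add_le_add (norm_mul_le _ _) (norm_mul_le _ _)
          _ ≤ (‖M‖ + 1) ^ k * η + (k * η * (‖M‖ + 1) ^ k) * ‖M‖ :=
              add_le_add (mul_le_mul h1 (hD k) (norm_nonneg _) (by positivity))
                (mul_le_mul_of_nonneg_right h2 (norm_nonneg _))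
          _ = η * (‖M‖ + 1) ^ k * (1 + k * ‖M‖) := by ring
          _ ≤ η * (‖M‖ + 1) ^ k * ((k + 1) * (‖M‖ + 1)) := by
              refine mul_le_mul_of_nonneg_left ?_ (by positivity)
              nlinarith [norm_nonneg M, (Nat.cast_nonneg k : (0:ℝ) ≤ k)]
          _ = ((k : ℝ) + 1) * η * (‖M‖ + 1) ^ (k + 1) := by ring
          _ = ((k + 1 : ℕ) : ℝ) * η * (‖M‖ + 1) ^ (k + 1) := by push_cast; ring

/-! ### The cocycle kill -/

/-- **COCYCLE KILL AT A LIMIT POINT.**  `u` classical Euler on `(−∞,0)` with the Cauchy–Lipschitz hypotheses, `l`-DSS (`l > 1`, `T = l^{2+ρ}`); a backward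
trajectory from `(τ₀, x₀)` with Type-I vorticity `(−s)‖ω(s, φ(s,τ₀,x₀))‖ ≤ C` (`s ≤ τ₀`) whose phase-lattice positions `q_j = l^{−j}φ(Tʲτ₀,τ₀,x₀)` converge to a
point `x*` at which the period map `F(x) = φ(τ₀,Tτ₀,lx)` has `‖DF(x*)^{k₀}‖ < (lT)^{k₀}` for some `k₀ ≥ 1`.  Then `ω(τ₀, x₀) = 0`.
(Cocycle `ω_j = l⁻¹DF(q_{j+1})ω_{j+1}`, Type I `‖ω_j‖ ≤ C'T^{−j}`, products of `k₀` near-`x*` factors have norm `< b < (lT)^{k₀}`: `‖ω_J‖ ≤ C'T^{−J}(b/(lT)^{k₀})^m → 0`.)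
[folklore] -/
theorem curl_eq_zero_of_tendsto_of_normPow_lt (hcl : IsClassicalEulerSolutionOn (Iio 0) 0 u p) (hL : ODE.IsUniformlyLipschitzOn u (Iio 0))
    (hl : 1 < l) (hρ : 0 < 2 + ρ) (hdss : ∀ τ : ℝ, τ < 0 → ∀ y, u τ y = (l ^ (1 + ρ)) • u ((l ^ (2 + ρ)) * τ) (l • y))
    {τ₀ : ℝ} (hτ₀ : τ₀ < 0) {x₀ xs : EuclideanSpace ℝ (Fin 3)} {C : ℝ}
    (hC : ∀ s : ℝ, s ≤ τ₀ → (-s) * ‖curl (u s) (ODE.evolutionMap u τ₀ s x₀)‖ ≤ C)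
    (hq : Tendsto (fun j : ℕ => (l ^ j)⁻¹ • ODE.evolutionMap u τ₀ ((l ^ (2 + ρ)) ^ j * τ₀) x₀) atTop (𝓝 xs))
    {k₀ : ℕ} (hk₀ : 0 < k₀)
    (hM : ‖(fderiv ℝ (fun x : EuclideanSpace ℝ (Fin 3) => ODE.evolutionMap u (l ^ (2 + ρ) * τ₀) τ₀ (l • x)) xs) ^ k₀‖ <
      (l * l ^ (2 + ρ)) ^ k₀) :
    curl (u τ₀) x₀ = 0 := by
  have hl0 : 0 < l := zero_lt_one.trans hl
  set T : ℝ := l ^ (2 + ρ) with hT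
  have hT1 : 1 < T := Real.one_lt_rpow hl hρ
  have hT0 : 0 < T := zero_lt_one.trans hT1
  have hTτ₀ : T * τ₀ < 0 := mul_neg_of_pos_of_neg hT0 hτ₀
  have hlT : 1 < l * T := by nlinarith
  set F : EuclideanSpace ℝ (Fin 3) → EuclideanSpace ℝ (Fin 3) := fun x => ODE.evolutionMap u (T * τ₀) τ₀ (l • x) with hFdef
  set M : EuclideanSpace ℝ (Fin 3) →L[ℝ] EuclideanSpace ℝ (Fin 3) := fderiv ℝ F xs with hMdef
  set q : ℕ → EuclideanSpace ℝ (Fin 3) := fun j => (l ^ j)⁻¹ • ODE.evolutionMap u τ₀ (T ^ j * τ₀) x₀ with hqdef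
  set w : ℕ → EuclideanSpace ℝ (Fin 3) := fun j => curl (u (T ^ j * τ₀)) (ODE.evolutionMap u τ₀ (T ^ j * τ₀) x₀) with hwdef
  -- smoothness of `F` and continuity of `DF`
  have hΦs : ContDiff ℝ ∞ (ODE.evolutionMap u (T * τ₀) τ₀) := contDiff_evolutionMap_any hcl hL hTτ₀ hτ₀
  have hF1 : ContDiff ℝ 1 F :=
    (hΦs.of_le (by exact_mod_cast le_top)).comp ((contDiff_id.const_smul l).of_le (by exact_mod_cast le_top))
  have hDFc : Continuous (fderiv ℝ F) := hF1.continuous_fderiv one_ne_zero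
  -- the cocycle
  have hcoc : ∀ j, w j = l⁻¹ • fderiv ℝ F (q (j + 1)) (w (j + 1)) := fun j =>
    curl_lattice_cocycle hcl hL hl hρ hdss hτ₀ x₀ j
  -- Type I along the lattice: `‖w j‖ ≤ C T^{−j}/(−τ₀)`
  have hTj0 : ∀ j : ℕ, T ^ j * τ₀ < 0 := fun j => mul_neg_of_pos_of_neg (pow_pos hT0 _) hτ₀
  have hTjτ : ∀ j : ℕ, T ^ j * τ₀ ≤ τ₀ := fun j => by have : 1 ≤ T ^ j := one_le_pow₀ hT1.le; nlinarith
  have hwj : ∀ j, ‖w j‖ ≤ C / (-(T ^ j * τ₀)) := by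
    intro j
    have h := hC (T ^ j * τ₀) (hTjτ j)
    rw [le_div_iff₀ (by linarith [hTj0 j]), mul_comm]
    exact h
  -- choose `η` so that products of `k₀` factors `η`-close to `M` have norm `≤ b < (lT)^{k₀}`
  set A : ℝ := ‖M‖ + 1 with hA
  have hA1 : 1 ≤ A := by rw [hA]; linarith [norm_nonneg M]
  set gap : ℝ := (l * T) ^ k₀ - ‖M ^ k₀‖ with hgap
  have hgap0 : 0 < gap := by rw [hgap]; linarith
  set η : ℝ := min 1 (gap / (2 * k₀ * A ^ k₀)) with hηdef
  have hη0 : 0 < η := lt_min one_pos (by positivity)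
  have hη1 : η ≤ 1 := min_le_left _ _
  have hηgap : (k₀ : ℝ) * η * A ^ k₀ ≤ gap / 2 := by
    have h1 : η ≤ gap / (2 * k₀ * A ^ k₀) := min_le_right _ _
    have h2 : 0 < (k₀ : ℝ) * A ^ k₀ := by positivity
    calc (k₀ : ℝ) * η * A ^ k₀ = η * ((k₀ : ℝ) * A ^ k₀) := by ring
      _ ≤ gap / (2 * k₀ * A ^ k₀) * ((k₀ : ℝ) * A ^ k₀) := mul_le_mul_of_nonneg_right h1 h2.le
      _ = gap / 2 := by field_simp
  set b : ℝ := ‖M ^ k₀‖ + gap / 2 with hb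
  have hb0 : 0 ≤ b := by positivity
  have hblt : b < (l * T) ^ k₀ := by rw [hb, hgap]; linarith
  -- eventually all `q j` are `η`-close in derivative
  obtain ⟨δ, hδ, hδη⟩ := Metric.continuousAt_iff.1 hDFc.continuousAt η hη0
  obtain ⟨J, hJ⟩ := Metric.tendsto_atTop.1 hq δ hδ
  have hclose : ∀ i, J ≤ i → ‖fderiv ℝ F (q i) - M‖ ≤ η := fun i hi => by
    have := hδη (hJ i hi); rw [dist_eq_norm] at this; exact this.le
  -- products along the lattice: `Pr n = DF(q_{J+1}) ∘ ⋯ ∘ DF(q_{J+n})`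
  set Pr : ℕ → (EuclideanSpace ℝ (Fin 3) →L[ℝ] EuclideanSpace ℝ (Fin 3)) :=
    fun n => Nat.rec (1 : EuclideanSpace ℝ (Fin 3) →L[ℝ] EuclideanSpace ℝ (Fin 3)) (fun k Pk => Pk * fderiv ℝ F (q (J + k + 1))) n with hPr
  have hPr0 : Pr 0 = 1 := rfl
  have hPrs : ∀ n, Pr (n + 1) = Pr n * fderiv ℝ F (q (J + n + 1)) := fun n => rfl
  -- `w J = l^{-n} Pr n (w (J+n))`
  have hiter : ∀ n, w J = (l ^ n)⁻¹ • Pr n (w (J + n)) := by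
    intro n
    induction n with
    | zero => simp [hPr0]
    | succ n ih =>
        rw [ih, hPrs, hcoc (J + n), show J + n + 1 = J + (n + 1) by ring, ContinuousLinearMap.mul_def,
          ContinuousLinearMap.comp_apply, map_smul, smul_smul, pow_succ, mul_inv]
  -- shifted products: general blocks `B s n = DF(q_{s+1}) ⋯ DF(q_{s+n})`
  set B : ℕ → ℕ → (EuclideanSpace ℝ (Fin 3) →L[ℝ] EuclideanSpace ℝ (Fin 3)) :=
    fun s n => Nat.rec (1 : EuclideanSpace ℝ (Fin 3) →L[ℝ] EuclideanSpace ℝ (Fin 3)) (fun k Pk => Pk * fderiv ℝ F (q (s + k + 1))) n with hB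
  have hB0 : ∀ s, B s 0 = 1 := fun s => rfl
  have hBs : ∀ s n, B s (n + 1) = B s n * fderiv ℝ F (q (s + n + 1)) := fun s n => rfl
  have hPrB : ∀ n, Pr n = B J n := by
    intro n; induction n with
    | zero => rfl
    | succ n ih => rw [hPrs, hBs, ih]
  -- concatenation: `B s (n + m) = B s n * B (s + n) m`
  have hcat : ∀ s n m, B s (n + m) = B s n * B (s + n) m := by
    intro s n m
    induction m with
    | zero => rw [add_zero, hB0, mul_one]
    | succ m ih => rw [← add_assoc, hBs, ih, hBs, mul_assoc, show s + n + m = s + (n + m) by ring]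
  -- block estimate: for `s ≥ J`, `‖B s k₀‖ ≤ b`
  have hblock : ∀ s, J ≤ s → ‖B s k₀‖ ≤ b := by
    intro s hs
    have h := (norm_prod_sub_pow_le (M := M) (D := fun k => fderiv ℝ F (q (s + k + 1))) (P := B s) (hB0 s) (hBs s) hη0.le hη1
      (fun i => hclose (s + i + 1) (by omega)) k₀).2
    calc ‖B s k₀‖ ≤ ‖M ^ k₀‖ + ‖B s k₀ - M ^ k₀‖ := norm_le_insert' _ _
      _ ≤ ‖M ^ k₀‖ + k₀ * η * A ^ k₀ := by linarith
      _ ≤ b := by rw [hb]; linarith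
  have hpow : ∀ m, ‖Pr (m * k₀)‖ ≤ b ^ m := by
    intro m
    induction m with
    | zero => rw [zero_mul, hPr0, pow_zero]; simp
    | succ m ih =>
        rw [Nat.succ_mul, hPrB, hcat, ← hPrB, pow_succ]
        calc ‖Pr (m * k₀) * B (J + m * k₀) k₀‖ ≤ ‖Pr (m * k₀)‖ * ‖B (J + m * k₀) k₀‖ := norm_mul_le _ _
          _ ≤ b ^ m * b := mul_le_mul ih (hblock _ (by omega)) (norm_nonneg _) (pow_nonneg hb0 _)
  -- the estimate `‖w J‖ ≤ (C/(−T^J τ₀)) · (b/(lT)^{k₀})^m`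
  set θ : ℝ := b / (l * T) ^ k₀ with hθ
  have hθ0 : 0 ≤ θ := div_nonneg hb0 (pow_nonneg (by positivity) _)
  have hθ1 : θ < 1 := (div_lt_one (pow_pos (by positivity) _)).2 hblt
  have hest : ∀ m, ‖w J‖ ≤ C / (-(T ^ J * τ₀)) * θ ^ m := by
    intro m
    rw [hiter (m * k₀), norm_smul, norm_inv, norm_pow, Real.norm_eq_abs, abs_of_pos hl0]
    have h1 : ‖Pr (m * k₀) (w (J + m * k₀))‖ ≤ b ^ m * (C / (-(T ^ (J + m * k₀) * τ₀))) :=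
      (ContinuousLinearMap.le_opNorm _ _).trans (mul_le_mul (hpow m) (hwj _) (norm_nonneg _) (pow_nonneg hb0 _))
    have hlm : 0 < l ^ (m * k₀) := pow_pos hl0 _
    rw [inv_mul_le_iff₀ hlm]
    refine h1.trans (le_of_eq ?_)
    rw [hθ, div_pow, ← pow_mul, mul_pow, pow_add]
    simp only [mul_comm k₀ m]
    have hT' : 0 < T ^ (m * k₀) := pow_pos hT0 _
    have hl' : 0 < l ^ (m * k₀) := pow_pos hl0 _
    have hTJ : 0 < -(T ^ J * τ₀) := by linarith [hTj0 J]
    have hτ0' : τ₀ ≠ 0 := hτ₀.ne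
    field_simp
  have hlim : Tendsto (fun m : ℕ => C / (-(T ^ J * τ₀)) * θ ^ m) atTop (𝓝 0) := by
    simpa using (tendsto_pow_atTop_nhds_zero_of_lt_one hθ0 hθ1).const_mul (C / (-(T ^ J * τ₀)))
  have hwJ0 : w J = 0 := by
    have h : ‖w J‖ ≤ 0 := ge_of_tendsto hlim (Eventually.of_forall hest)
    exact norm_eq_zero.1 (le_antisymm h (norm_nonneg _))
  -- transport forward from `T^J τ₀` to `τ₀`
  have hcauchy := curl_evolutionMap_any hcl hL (hTj0 J) hτ₀ (ODE.evolutionMap u τ₀ (T ^ J * τ₀) x₀)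
  rw [hL.evolutionMap_symm (convex_Iio 0) (mem_Iio.2 hτ₀) (mem_Iio.2 (hTj0 J))] at hcauchy
  rw [hcauchy]
  have : curl (u (T ^ J * τ₀)) (ODE.evolutionMap u τ₀ (T ^ J * τ₀) x₀) = 0 := hwJ0
  rw [this, map_zero]

end Summit.NavierStokesRegularity.NavierStokesRegularity.Theorems.PowerGaugeEulerLiouville.DSSNodes

end
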